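import Summits.Langlands.Langlands.Theses.RootDecomp1
import Summits.Langlands.Langlands.Theorems.OrdinaryPrimeTransportReciprocityUpToIrreducibilityRegularSectorAway
import Summits.Langlands.Langlands.Theorems.OrdinaryPrimeTransportReciprocityUpToIrreducibilityRankOneAwayUnramified
import HarnessLib

/-!
# `RootDecomp1.SatakePlacesAllData` — proved outright (item stmt-Langlands-23602)

Proof of the support leaf `Summit.Langlands.Langlands.Theses.RootDecomp1.SatakePlacesAllData`
(binder `hG` of the `closes` theorems of routes RootDecomp1, RetentionCarving, PurityCarving):

> for every number field `K`, every reciprocity datum `Rec`, every `n ≥ 1`, every cuspidal `π` of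
> `GL_n(𝔸_K)`, every `ℓ`, `ι : ℚ̄_ℓ ≃ ℂ`, `ρ : Γ_K → GL_n(ℚ̄_ℓ)` and every place `v ∤ ℓ`:
> Satake–Frobenius compatibility of `(π, ι, ρ)` at `v` implies the summit's local–global clause
> `LocalGlobalCompatibleAt Rec ι π ρ v`.

NO named fact is used: at `v ∤ ℓ` the Fontaine clause of `LocalGlobalCompatibleAt` is vacuous, and the
`ℓ`-adic clause is the Grothendieck–Deligne recipe at an unramified `ρ|_{Γ_{K_v}}`.  Both ranks are
already in the tree and are CITED BY NAME (gate lint `dedup.landed`: the lens-1 g27 / writer-1 g8 kit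
re-derived them as `SatakePlacesAllDataProof.*_spad` copies; the gate identified the copies with the
landed declarations below, whose modules are built and import no route file):

* `n ≥ 2`: `ReciprocityUpToIrreducibility.localGlobalCompatibleAt_away_of_satakeFrobCompatibleAt`
  (`Theorems/OrdinaryPrimeTransportReciprocityUpToIrreducibilityRegularSectorAway`): a local component
  `π_v` (Harish-Chandra admissibility), a transport `rℂ` of `(ρ|_{W_{K_v}}, 0)` along `ι` whose
  geometric Frobenii have characteristic polynomial `∏_{a ∈ α} (X - a)`, and `rℂ^{F-ss} ∈ rec_v(π_v)`
  because every Frobenius-semisimple representative of `rec_v(π_v)` is unramified with that polynomial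
  (Carayol's deduction from clauses (ii), (iii-L), (v) of the local Langlands datum) plus uniqueness of
  the unramified Frobenius-semisimple parameter (Brauer–Nesbitt for the monoid `ℕ`).
* `n = 1`: `ReciprocityUpToIrreducibility.rankOne_localGlobalCompatibleAt_away_of_satakeFrobCompatibleAt`
  (`Theorems/OrdinaryPrimeTransportReciprocityUpToIrreducibilityRankOneAwayUnramified`), applied to the
  Hecke character `χ` through which `GL₁(𝔸_K)` acts on `π` (`AutomorphicRepData.exists_heckeCharacter_glOne`),
  unramified at `v` because `π` has a Satake parameter there
  (`AutomorphicRepData.isUnramifiedAt_heckeCharacter_glOne`) — the wrapper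
  `SatakePlacesAllDataProof.rankOne_localGlobalCompatibleAt_away_spad` below.

Provenance: lens-1 g27 kernel twin (sha256 03b6ede1a139d5ff), split by decomp-langlands-writer-1 g8
(critic row 329); landed by leafhand-langlands-land23602-1 with the gate's `dedup.landed` repair (parts
1/3 `RootDecomp1SatakePlacesAllDataLocal` landed as support; the part-2 re-derivations are superseded by
the citations above).  No definitions, no sorry, standard axioms.


## References

* H. Carayol, Ann. Sci. ÉNS 19 (1986), Thm. (A). [CarayolASENS1986]
* M. Harris, R. Taylor, Ann. of Math. Stud. 151 (2001), Thm. A (i), (ii), (v). [HarrisTaylorAMS2001]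
* J. Tate, *Number theoretic background*, Corvallis 1979, (1.4.1)–(1.4.6), (4.1.2)–(4.2.1). [TateCorvallis1979]
* P. Deligne, *Les constantes des équations fonctionnelles des fonctions L*, Antwerp II (1973), §8. [DeligneAntwerpII1973]
* K. Buzzard, T. Gee, LMS Lecture Notes 414 (2014), Conj. 3.2.1–3.2.2, Rem. 3.2.5. [BuzzardGeeLMS2014]
* N. Bourbaki, *Algèbre* VIII (2012), § 20 n° 6. [BourbakiAlgebreVIII2012]
* H. Jacquet, J. A. Shalika, Amer. J. Math. 103 (1981), §2. [JacquetShalika1981]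
* D. Flath, Corvallis 1979, Thm. 3. [FlathCorvallis1979]
-/

noncomputable section

set_option linter.dupNamespace false -- project-wide option (lakefile weak.linter.dupNamespace); `Summit.Langlands.Langlands` is the mandated namespace

open scoped MatrixGroups Matrix NumberField Classical Polynomial
open Filter IsDedekindDomain Field Polynomial MeasureTheory
open Literature.NumberTheory.Automorphic Literature.NumberTheory.GaloisRepresentations
open Literature.NumberTheory.PAdicHodge
open Summit.Langlands
open Summit.Langlands.Langlands.Theorems.VarmaWeilTracesUnramified
open Summit.Langlands.Langlands.Theorems.ReciprocityUpToIrreducibility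


namespace Summit.Langlands.Langlands.Theorems

namespace SatakePlacesAllDataProof

/-! ### Rank one at `v ∤ ℓ`: every cuspidal `π` of `GL₁(𝔸_K)` -/

section RankOne

variable {K : Type} [Field K] [NumberField K] {ℓ : ℕ} [Fact ℓ.Prime]
  {hcpt : isCompact_glFiniteIntegralLevel 1 K}

/-- **Rank one, every cuspidal `π` of `GL₁(𝔸_K)`, `v ∤ ℓ`**: `GL₁(𝔸_K)` acts on `π` through `χ ∘ det`
for a Hecke character `χ` (`AutomorphicRepData.exists_heckeCharacter_glOne`), which is unramified at `v`
since `π` has a Satake parameter at `v` (`AutomorphicRepData.isUnramifiedAt_heckeCharacter_glOne`).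
[cite: BuzzardGeeLMS2014, Conj. 3.2.1–3.2.2 (n = 1)] [cite: Weil1956, §1–§2] -/
theorem rankOne_localGlobalCompatibleAt_away_spad (Rec : ReciprocityData K) (ι : PadicAlgCl ℓ ≃+* ℂ)
    (π : CuspidalAutomorphicRepData 1 K hcpt) (ρ : FramedGaloisRep K (PadicAlgCl ℓ) 1)
    {v : HeightOneSpectrum (𝓞 K)} (hv : ((ℓ : ℕ) : 𝓞 K) ∉ v.asIdeal)
    (hsat : SatakeFrobCompatibleAt ι π.1 ρ v) :
    LocalGlobalCompatibleAt Rec ι π.1 ρ v := by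
  obtain ⟨χ, hχ⟩ := π.1.exists_heckeCharacter_glOne
  obtain ⟨α, hα, -⟩ := id hsat
  exact rankOne_localGlobalCompatibleAt_away_of_satakeFrobCompatibleAt Rec ι π.1 χ hχ ρ hv
    (π.1.isUnramifiedAt_heckeCharacter_glOne hχ hα) hsat

end RankOne

end SatakePlacesAllDataProof

/-- **`RootDecomp1.SatakePlacesAllData` holds** (item stmt-Langlands-23602): at every place `v ∤ ℓ`,
for every `n ≥ 1`, every reciprocity datum and every cuspidal `π`, Satake–Frobenius compatibility of
`(π, ι, ρ)` at `v` implies `LocalGlobalCompatibleAt Rec ι π ρ v` — rank `n ≥ 2` by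
`ReciprocityUpToIrreducibility.localGlobalCompatibleAt_away_of_satakeFrobCompatibleAt`, rank one by `rankOne_localGlobalCompatibleAt_away_spad`.
[cite: BuzzardGeeLMS2014, Conj. 3.2.1–3.2.2] [cite: CarayolASENS1986, Thm. (A)]
[cite: HarrisTaylorAMS2001, Thm. A (i), (ii), (v)] -/
theorem SatakePlacesAllData_proof :
    Summit.Langlands.Langlands.Theses.RootDecomp1.SatakePlacesAllData := by
  intro K _ _ Rec n hcpt hn π ℓ _ ι ρ v hv hsat
  rcases Nat.lt_or_ge 1 n with hn1 | hn1
  · exact localGlobalCompatibleAt_away_of_satakeFrobCompatibleAt hn1 Rec ι π ρ hv hsat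
  · obtain rfl : n = 1 := le_antisymm hn1 hn
    exact SatakePlacesAllDataProof.rankOne_localGlobalCompatibleAt_away_spad Rec ι π ρ hv hsat

end Summit.Langlands.Langlands.Theorems

end
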